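import Summits.BirchSwinnertonDyer.BirchSwinnertonDyer.Theorems.KimAtThreeKolyvaginMinimalCertificate
import HarnessLib

/-!
# Route `KimAtThreeKolyvagin` (rung W2), crux `ShallowEqDeepAtTorsionFree`: it costs NOTHING beyond the certificate lane of `DeepLowerAtThree` and the crux `DeepUpperAtThree`

Write, on one row of the route, `a = ∂⁽⁰⁾(δ̃)`, `s = ord₃ #Ш(E/ℚ)(3)`, `d = ∂^{(∞)}_{deep}(δ̃)` and
`∂ = ∂^{(∞)}(δ̃)` (all-levels infimum). The three cruxes read: 19075 `DeepLowerAtThree`: `a ≤ s + d`;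
19076 `DeepUpperAtThree`: `s + d ≤ a`; 19077 `ShallowEqDeepAtTorsionFree`: `d ≤ ∂`. The CERTIFICATE
LANE is the statement, for a threshold `K`,
  (C_K) every certificate of depth `j + 1` (`δ̃_n ∉ 3^{j+1}ℤ₃/I_n`) at a cyclic level `n` of depth
        `k ≥ K + j` forces `a ≤ s + j`
— the `f`-currency shape of the conclusion of cell n1011's (a′) END theorems
(`GaloisImage.Assembly.padicValRat_le_of_kolyvaginProduct{,_deep}`, there with `K + j ≤ L + 1` and
`K = 2t + 1`, i.e. **`K = 1` on the crux's `t = 0` rows**), which kim3 proved implies 19075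
(`KimAtThreeKolyvaginMinimalCertificate.deepLowerAtThree_of_minimalCertificateBound`, any `K`).

THIS FILE: the threshold-free lane (C₁) (= (C_K) with `K + j ≤ k` for `K = 0`, equivalently kim3's
END shape with `K = 1`: a certificate of depth `j + 1` is automatically witnessed at a level of depth
`≥ j + 1`) is, GIVEN crux 19076, EQUIVALENT to crux 19077 on the row, and GIVEN 19075 ∧ 19077 it
holds. Consequently item 19077 needs NO Galois-side input of its own: the END road that discharges
19075 at `t = 0` (threshold `1`), together with 19076, closes 19077 (pure `ℕ∞` bookkeeping below).

* `certificateBound_of_thresholdOne` — kim3's uniform bound with threshold `K = 1`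
  (`∀ j k n, 1 + j ≤ k → n ∈ 𝒩_k → …`; the END shape at `t = 0`) gives the threshold-free (C):
  `∀ j n, cyclic n → δ̃_n ∉ 3^{j+1} → a ≤ s + j`;
* `shallowEqDeep_conclusion_of_deepUpper_of_certificateBound` — **19076-conclusion ∧ (C) ⟹
  19077-conclusion** on a row (general `p`);
* `certificateBound_of_deepLower_of_shallowEqDeep` — **19075-conclusion ∧ 19077-conclusion ⟹ (C)**;
* `shallowEqDeep_iff_certificateBound_of_deepLower_of_deepUpper` — given 19075 ∧ 19076 on the row,
  19077-conclusion ⟺ (C);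
* `shallowEqDeepAtTorsionFree_of_deepUpperAtThree_of_minimalCertificateBound` — item level: crux
  19076 (by name) + the MINIMAL-certificate statement with threshold `K = 1` in kim3's shape (inline
  hypothesis; at `t = 0` exactly n1011's END conclusion) ⟹ crux 19077; the SAME hypothesis gives 19075
  by kim3's theorem (`deepLower_and_shallowEqDeep_of_deepUpper_of_minimalCertificateBound`);
* `shallowEqDeep_datum_of_deepUpper_of_endShapeBound` — parametrised-row form: kim3's
  `deepLower_datum_of_endShapeBound` hypothesis `hEnd` with `K = 1` (same `ψ`, sub-level vanishing,
  BSD currency, period transfer) + 19076's conclusion on the row ⟹ 19077's conclusion on the row.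

* (append) `…_of_certificateBoundTorsionFree`, `…_of_minimalCertificateBoundTorsionFree` — the
  item-level statements with `H` asked on the crux's own rows only (`t = 0` binder carried).

Nothing is asserted: (C), `hEnd` and the cruxes enter as hypotheses. [cite: Kim2025RefinedTNC, Thm 1.1]
[cite: Kim2022StructureSelmer, Thm. 1.9 (6), Thm. 3.13, §1.5.1 (PDF p. 7)] [cite: MazurRubin2004, Thm. 5.2.12, Cor. 5.2.13]
-/

set_option autoImplicit false
-- the Theorems namespace of a single-conjunct summit repeats the summit name by design (D-0017)
set_option linter.dupNamespace false

noncomputable section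

open scoped MatrixGroups ModularForm Classical

open CongruenceSubgroup WeierstrassCurve Literature.NumberTheory.EllipticCurves
  Literature.NumberTheory.EllipticCurves.ModularForms

namespace Summit.BirchSwinnertonDyer.BirchSwinnertonDyer.Theorems.KimAtThreeShallowEqDeepCertificateBound

open Summit.BirchSwinnertonDyer.Rank1Residual.Additive
open Summit.BirchSwinnertonDyer.BirchSwinnertonDyer.Theses.KimAtThreeKolyvagin
open Summit.BirchSwinnertonDyer.BirchSwinnertonDyer.Theorems.KimAtThreeKolyvaginDeepUpperRung
open Summit.BirchSwinnertonDyer.BirchSwinnertonDyer.Theorems.KimAtThreeKolyvaginUnitLevelOneRungs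
open Summit.BirchSwinnertonDyer.BirchSwinnertonDyer.Theorems.KimAtThreeKolyvaginCertificateDictionary
open Summit.BirchSwinnertonDyer.BirchSwinnertonDyer.Theorems.KimAtThreeKolyvaginDeepLowerOfCertificate
open Summit.BirchSwinnertonDyer.BirchSwinnertonDyer.Theorems.KimAtThreeKolyvaginMinimalCertificate

/-! ### One row, general `p`: the threshold-free certificate lane (C) versus the three conclusions -/

section Row

variable (W : WeierstrassCurve ℚ) [W.IsGloballyMinimal] (p : ℕ) {N : ℕ} (f : CuspForm (Gamma0 N) 2)

/-- **The END shape with threshold `K = 1` IS the threshold-free lane.** If `∂⁽⁰⁾(δ̃) ≤ s + j` holds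
for every certificate of depth `j + 1` at a cyclic level `n ∈ 𝒩_k` with `1 + j ≤ k` (kim3's uniform
bound with `K = 1`; at `t = 0` the shape of n1011's END theorems, `K = 2t + 1`), then it holds for
EVERY certificate of depth `j + 1` at every cyclic level: the certificate is witnessed modulo `p^{k'}`
for some `1 ≤ k' ≤ j + 1` with `n ∈ 𝒩_{k'}`, which is a certificate of depth `k'` at depth `k'`, so
`∂⁽⁰⁾ ≤ s + (k' − 1) ≤ s + j`. [cite: Kim2022StructureSelmer, §1.5.1 (PDF p. 7), Def. 2.13 (PDF p. 14)] -/
theorem certificateBound_of_thresholdOne (s : ℕ)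
    (h : ∀ j k n : ℕ, 1 + j ≤ k → IsCyclicKolyvaginLevel W p n → Kato.IsKolyvaginProduct W p k n →
      ¬ KuriharaDivisibleAt W p f n (j + 1) → kuriharaPartial W p f 0 ≤ ((s + j : ℕ) : ℕ∞)) :
    ∀ j n : ℕ, IsCyclicKolyvaginLevel W p n → ¬ KuriharaDivisibleAt W p f n (j + 1) →
      kuriharaPartial W p f 0 ≤ ((s + j : ℕ) : ℕ∞) := by
  intro j n hn hcert
  obtain ⟨k', hk'1, hk'j, hk', ψ, hψ, hne⟩ :=
    exists_kuriharaNumber_ne_zero_of_not_kuriharaDivisibleAt W p f hcert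
  haveI : NeZero n := ⟨hk'.ne_zero⟩
  -- a certificate of depth `k'` at the depth-`k'` level `n`
  have hcert' : ¬ KuriharaDivisibleAt W p f n ((k' - 1) + 1) := by
    rw [Nat.sub_add_cancel hk'1]
    exact not_kuriharaDivisibleAt_of_kuriharaNumber_ne_zero W p f le_rfl hk' ψ hψ hne
  refine (h (k' - 1) k' n (by omega) hn hk' hcert').trans ?_
  exact_mod_cast (show s + (k' - 1) ≤ s + j by omega)

/-- **19076-conclusion ∧ (C) ⟹ 19077-conclusion** (one row, general `p`). If `s + d ≤ ∂⁽⁰⁾(δ̃)` with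
`d = ∂^{(∞)}_{deep}(δ̃)` (the conclusion of `DeepUpperAtThree` with `s = ord₃ #Ш(3)`) and every
certificate of depth `j + 1` at any cyclic level forces `∂⁽⁰⁾(δ̃) ≤ s + j`, then
`∂^{(∞)}_{deep}(δ̃) ≤ ∂^{(∞)}(δ̃)`: a shallow certificate of depth `j + 1` gives `s + d ≤ ∂⁽⁰⁾ ≤ s + j`,
i.e. `d ≤ j`, which is `shallowEqDeep_conclusion_iff_noShallowCertificate`.
[cite: Kim2025RefinedTNC, Thm 1.1] [cite: Kim2022StructureSelmer, §1.5.1 (PDF p. 7)] -/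
theorem shallowEqDeep_conclusion_of_deepUpper_of_certificateBound (s : ℕ)
    (hU : ∃ d : ℕ, kuriharaPartialDeepInfty W p f = d ∧
      ((s + d : ℕ) : ℕ∞) ≤ kuriharaPartial W p f 0)
    (hC : ∀ j n : ℕ, IsCyclicKolyvaginLevel W p n → ¬ KuriharaDivisibleAt W p f n (j + 1) →
      kuriharaPartial W p f 0 ≤ ((s + j : ℕ) : ℕ∞)) :
    kuriharaPartialDeepInfty W p f ≤ kuriharaPartialInfty W p f := by
  obtain ⟨d, hd, hle⟩ := hU
  refine (shallowEqDeep_conclusion_iff_noShallowCertificate W p f).mpr fun n j hn hcert => ?_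
  have h := hle.trans (hC j n hn hcert)
  have h' : s + d ≤ s + j := by exact_mod_cast h
  rw [hd]
  exact_mod_cast (show d ≤ j by omega)

/-- **19075-conclusion ∧ 19077-conclusion ⟹ (C)** (one row, general `p`): a certificate of depth
`j + 1` at a cyclic level `n` has `ord δ̃_n ≤ j`, so `d ≤ ∂^{(∞)} ≤ ord δ̃_n ≤ j` (19077) and
`∂⁽⁰⁾ ≤ s + d ≤ s + j` (19075). [cite: Kim2025RefinedTNC, Thm 1.1] [cite: MazurRubin2004, Cor. 5.2.13] -/
theorem certificateBound_of_deepLower_of_shallowEqDeep (s : ℕ)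
    (hL : ∃ d : ℕ, kuriharaPartialDeepInfty W p f = d ∧
      kuriharaPartial W p f 0 ≤ ((s + d : ℕ) : ℕ∞))
    (hS : kuriharaPartialDeepInfty W p f ≤ kuriharaPartialInfty W p f) :
    ∀ j n : ℕ, IsCyclicKolyvaginLevel W p n → ¬ KuriharaDivisibleAt W p f n (j + 1) →
      kuriharaPartial W p f 0 ≤ ((s + j : ℕ) : ℕ∞) := by
  intro j n hn hcert
  obtain ⟨d, hd, hle⟩ := hL
  have hdj : kuriharaPartialDeepInfty W p f ≤ (j : ℕ∞) :=
    (shallowEqDeep_conclusion_iff_noShallowCertificate W p f).mp hS n j hn hcert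
  rw [hd] at hdj
  have hdj' : d ≤ j := by exact_mod_cast hdj
  exact hle.trans (by exact_mod_cast (show s + d ≤ s + j by omega))

/-- **Given 19075 ∧ 19076 on the row, 19077-conclusion ⟺ the threshold-free certificate lane (C).**
[cite: Kim2025RefinedTNC, Thm 1.1] [cite: MazurRubin2004, Thm. 5.2.12, Cor. 5.2.13] -/
theorem shallowEqDeep_iff_certificateBound_of_deepLower_of_deepUpper (s : ℕ)
    (hL : ∃ d : ℕ, kuriharaPartialDeepInfty W p f = d ∧
      kuriharaPartial W p f 0 ≤ ((s + d : ℕ) : ℕ∞))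
    (hU : ∃ d : ℕ, kuriharaPartialDeepInfty W p f = d ∧
      ((s + d : ℕ) : ℕ∞) ≤ kuriharaPartial W p f 0) :
    kuriharaPartialDeepInfty W p f ≤ kuriharaPartialInfty W p f ↔
      ∀ j n : ℕ, IsCyclicKolyvaginLevel W p n → ¬ KuriharaDivisibleAt W p f n (j + 1) →
        kuriharaPartial W p f 0 ≤ ((s + j : ℕ) : ℕ∞) :=
  ⟨certificateBound_of_deepLower_of_shallowEqDeep W p f s hL,
    shallowEqDeep_conclusion_of_deepUpper_of_certificateBound W p f s hU⟩

/-- **19076-conclusion + kim3's MINIMAL-certificate bound with threshold `K = 1` ⟹ 19077-conclusion**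
(one row, general `p`): the minimal shape is upgraded to all certificates by
`uniformCertificateBound_of_minimal`, the threshold removed by `certificateBound_of_thresholdOne`.
[cite: Kim2022StructureSelmer, Thm. 1.9 (6), Thm. 3.13] [cite: Kim2025RefinedTNC, Thm 1.1] -/
theorem shallowEqDeep_conclusion_of_deepUpper_of_minimalCertificateBound (s : ℕ)
    (hU : ∃ d : ℕ, kuriharaPartialDeepInfty W p f = d ∧
      ((s + d : ℕ) : ℕ∞) ≤ kuriharaPartial W p f 0)
    (hmin : ∀ j k c : ℕ, 1 + j ≤ k → IsCyclicKolyvaginLevel W p c → Kato.IsKolyvaginProduct W p k c →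
      c ≠ 1 → ¬ KuriharaDivisibleAt W p f c (j + 1) →
      (∀ d, d ∣ c → d ≠ 1 → d ≠ c → KuriharaDivisibleAt W p f d (j + 1)) →
        kuriharaPartial W p f 0 ≤ ((s + j : ℕ) : ℕ∞)) :
    kuriharaPartialDeepInfty W p f ≤ kuriharaPartialInfty W p f :=
  shallowEqDeep_conclusion_of_deepUpper_of_certificateBound W p f s hU
    (certificateBound_of_thresholdOne W p f s (uniformCertificateBound_of_minimal W p f s 1 hmin))

end Row

/-! ### Item level: crux 19076 + the `K = 1` minimal-certificate statement ⟹ cruxes 19077 AND 19075 -/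

/-- **Crux `ShallowEqDeepAtTorsionFree` ⟸ crux `DeepUpperAtThree` (by name) + the MINIMAL-certificate
statement with threshold `K = 1`** (inline hypothesis `H₁`, NOT a tree fact: on every row of the crux
a certificate of depth `j + 1` at a cyclic level `c ≠ 1` of depth `k ≥ 1 + j`, all of whose divisors
`d ∉ {1, c}` are `3^{j+1}`-divisible, forces `∂⁽⁰⁾(δ̃) ≤ ord₃ #Ш(E/ℚ)(3) + j` — at `t = 0` the
`f`-currency conclusion of n1011's END theorem `Assembly.padicValRat_le_of_kolyvaginProduct_deep`,
threshold `2t + 1 = 1`). The `E(ℚ₃)[3] = 0` binder of 19077 is not used by the bookkeeping (it is what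
makes `K = 1` available on the Galois side). [cite: Kim2025RefinedTNC, Thm 1.1]
[cite: Kim2022StructureSelmer, Thm. 1.9 (6), Thm. 3.13] [cite: MazurRubin2004, Thm. 5.2.12, Cor. 5.2.13] -/
theorem shallowEqDeepAtTorsionFree_of_deepUpperAtThree_of_minimalCertificateBound (hU : DeepUpperAtThree)
    (H₁ : ∀ (W : WeierstrassCurve ℚ) [W.IsElliptic] [W.IsGloballyMinimal],
      (∀ n : ℕ, W.HasSurjectiveModNGaloisRep (3 ^ n : ℕ)) → Finite W.sha →
      ∀ {N : ℕ} [NeZero N] (f : CuspForm (Gamma0 N) 2), IsNewformOf W f →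
      (∀ r : ℚ, ratPlusSymbol f r ≠ 0 → 0 ≤ padicValRat 3 (ratPlusSymbol f r)) →
      kuriharaVanishingOrder W 3 f = 0 →
      ∀ j k c : ℕ, 1 + j ≤ k → IsCyclicKolyvaginLevel W 3 c →
        Kato.IsKolyvaginProduct W 3 k c → c ≠ 1 → ¬ KuriharaDivisibleAt W 3 f c (j + 1) →
        (∀ d, d ∣ c → d ≠ 1 → d ≠ c → KuriharaDivisibleAt W 3 f d (j + 1)) →
          kuriharaPartial W 3 f 0 ≤
            ((padicValNat 3 (Nat.card (AddCommGroup.primaryComponent W.sha 3)) + j : ℕ) : ℕ∞)) :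
    ShallowEqDeepAtTorsionFree := by
  intro W _ _ htower _ hfin N _ f hf hint hord
  exact shallowEqDeep_conclusion_of_deepUpper_of_minimalCertificateBound W 3 f _
    (hU W htower hfin f hf hint hord) (H₁ W htower hfin f hf hint hord)

/-- **The same `K = 1` statement gives BOTH deep-lane cruxes it touches**: `DeepLowerAtThree` by kim3's
`deepLowerAtThree_of_minimalCertificateBound` (any threshold) and, with `DeepUpperAtThree`,
`ShallowEqDeepAtTorsionFree` — item 19077 adds no input of its own to the END road at `t = 0`.
[cite: Kim2025RefinedTNC, Thm 1.1] [cite: MazurRubin2004, Thm. 5.2.12, Cor. 5.2.13] -/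
theorem deepLower_and_shallowEqDeep_of_deepUpper_of_minimalCertificateBound (hU : DeepUpperAtThree)
    (H₁ : ∀ (W : WeierstrassCurve ℚ) [W.IsElliptic] [W.IsGloballyMinimal],
      (∀ n : ℕ, W.HasSurjectiveModNGaloisRep (3 ^ n : ℕ)) → Finite W.sha →
      ∀ {N : ℕ} [NeZero N] (f : CuspForm (Gamma0 N) 2), IsNewformOf W f →
      (∀ r : ℚ, ratPlusSymbol f r ≠ 0 → 0 ≤ padicValRat 3 (ratPlusSymbol f r)) →
      kuriharaVanishingOrder W 3 f = 0 →
      ∀ j k c : ℕ, 1 + j ≤ k → IsCyclicKolyvaginLevel W 3 c →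
        Kato.IsKolyvaginProduct W 3 k c → c ≠ 1 → ¬ KuriharaDivisibleAt W 3 f c (j + 1) →
        (∀ d, d ∣ c → d ≠ 1 → d ≠ c → KuriharaDivisibleAt W 3 f d (j + 1)) →
          kuriharaPartial W 3 f 0 ≤
            ((padicValNat 3 (Nat.card (AddCommGroup.primaryComponent W.sha 3)) + j : ℕ) : ℕ∞)) :
    DeepLowerAtThree ∧ ShallowEqDeepAtTorsionFree :=
  ⟨deepLowerAtThree_of_minimalCertificateBound fun W _ _ htower hfin _ _ f hf hint hord =>
      ⟨1, H₁ W htower hfin f hf hint hord⟩,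
    shallowEqDeepAtTorsionFree_of_deepUpperAtThree_of_minimalCertificateBound hU H₁⟩

/-- **Conversely, the two cruxes `DeepLowerAtThree ∧ ShallowEqDeepAtTorsionFree` give the threshold-free
lane on every `t = 0` row** — so on the crux's rows (C) is NECESSARY as well.
[cite: Kim2025RefinedTNC, Thm 1.1] [cite: MazurRubin2004, Cor. 5.2.13] -/
theorem certificateBound_of_deepLowerAtThree_of_shallowEqDeepAtTorsionFree
    (hL : DeepLowerAtThree) (hS : ShallowEqDeepAtTorsionFree)
    (W : WeierstrassCurve ℚ) [W.IsElliptic] [W.IsGloballyMinimal]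
    (htower : ∀ n : ℕ, W.HasSurjectiveModNGaloisRep (3 ^ n : ℕ))
    (ht0 : Nat.card {Q : (W.baseChange ℚ_[3]).toAffine.Point // (3 : ℕ) • Q = 0} = 1)
    (hfin : Finite W.sha) {N : ℕ} [NeZero N] (f : CuspForm (Gamma0 N) 2) (hf : IsNewformOf W f)
    (hint : ∀ r : ℚ, ratPlusSymbol f r ≠ 0 → 0 ≤ padicValRat 3 (ratPlusSymbol f r))
    (hord : kuriharaVanishingOrder W 3 f = 0) :
    ∀ j n : ℕ, IsCyclicKolyvaginLevel W 3 n → ¬ KuriharaDivisibleAt W 3 f n (j + 1) →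
      kuriharaPartial W 3 f 0 ≤
        ((padicValNat 3 (Nat.card (AddCommGroup.primaryComponent W.sha 3)) + j : ℕ) : ℕ∞) :=
  certificateBound_of_deepLower_of_shallowEqDeep W 3 f _ (hL W htower hfin f hf hint hord)
    (hS W htower ht0 hfin f hf hint hord)

/-! ### Parametrised row: kim3's END-shape hypothesis with `K = 1` + 19076's conclusion ⟹ 19077's conclusion -/

/-- **19077's conclusion on a parametrised row from the END-SHAPE bound with `K = 1` and 19076's
conclusion.** For a tower row with a parametrisation datum `D`, the period transfer, `ord(δ̃) = 0` and
the hypothesis `hEnd` of kim3's `deepLower_datum_of_endShapeBound` AT THRESHOLD `K = 1` (BSD currency: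
ONE system `ψ`, `kuriharaNumber D.f (3^{j'}) n ψ ≠ 0`, sub-level vanishing `⟹ ∃ q, L(E,1)/Ω(W) = q ∧
ord₃ q ≤ ord₃ #Ш(3) + (j' − 1)` whenever `1 + j' ≤ L + 1`, `n ∈ 𝒩_L` — at `t = 0` the conclusion of
n1011's `Assembly.padicValRat_le_of_kolyvaginProduct_deep` verbatim), IF in addition 19076's conclusion
holds on the row (`s + d ≤ ∂⁽⁰⁾`), THEN `∂^{(∞)}_{deep}(δ̃) ≤ ∂^{(∞)}(δ̃)`. (kim3's theorem gives 19075's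
conclusion from `hEnd` alone.) [cite: Kim2022StructureSelmer, Thm. 1.9 (6), Thm. 3.13]
[cite: Kim2025RefinedTNC, Thm 1.1] [cite: MazurRubin2004, Thm. 5.2.12, Cor. 5.2.13] -/
theorem shallowEqDeep_datum_of_deepUpper_of_endShapeBound
    (W : WeierstrassCurve ℚ) [W.IsElliptic] [W.IsGloballyMinimal]
    (htower : ∀ n : ℕ, W.HasSurjectiveModNGaloisRep (3 ^ n : ℕ))
    {N : ℕ} [NeZero N] (D : ModularParametrizationData W N)
    (hper : ∃ u : ℚ, ‖(u : ℚ_[3])‖ = 1 ∧ W.realPeriodRat = u * plusPeriod D.f)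
    (hord : kuriharaVanishingOrder W 3 D.f = 0)
    (hEnd : ∀ (j' L n : ℕ), 1 ≤ j' → 1 + j' ≤ L + 1 → IsCyclicKolyvaginLevel W 3 n →
      ∀ hL : Kato.IsKolyvaginProduct W 3 L n,
      ∀ ψ : (ℓ : ℕ) → (ZMod ℓ)ˣ →* Multiplicative (ZMod (3 ^ j')),
        (∀ ℓ ∈ n.primeFactors, Function.Surjective (ψ ℓ)) →
        (haveI : NeZero n := ⟨hL.ne_zero⟩; kuriharaNumber D.f (3 ^ j') n ψ ≠ 0) →
        (∀ d : ℕ, d ∣ n → 1 < d → d < n → ∀ [NeZero d], kuriharaNumber D.f (3 ^ j') d ψ = 0) →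
        ∃ q : ℚ, W.entireLFunction 1 / (W.realPeriodRat : ℂ) = (q : ℂ) ∧
          padicValRat 3 q ≤
            (padicValNat 3 (Nat.card (AddCommGroup.primaryComponent W.sha 3)) : ℤ) + ((j' - 1 : ℕ) : ℤ))
    (hU : ∃ d : ℕ, kuriharaPartialDeepInfty W 3 D.f = d ∧
      ((padicValNat 3 (Nat.card (AddCommGroup.primaryComponent W.sha 3)) + d : ℕ) : ℕ∞) ≤
        kuriharaPartial W 3 D.f 0) :
    kuriharaPartialDeepInfty W 3 D.f ≤ kuriharaPartialInfty W 3 D.f := by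
  haveI : Fact (Nat.Prime 3) := ⟨Nat.prime_three⟩
  set s := padicValNat 3 (Nat.card (AddCommGroup.primaryComponent W.sha 3)) with hs
  have hirr : W.HasIrreducibleModPGaloisRep 3 :=
    hasIrreducibleModPGaloisRep_of_hasSurjectiveModNGaloisRep W 3 (by simpa using htower 1)
  have h0 : ratPlusSymbol D.f 0 ≠ 0 :=
    ratPlusSymbol_zero_ne_zero_of_kuriharaVanishingOrder_eq_zero W 3 D.f hord
  refine shallowEqDeep_conclusion_of_deepUpper_of_minimalCertificateBound W 3 D.f s hU ?_
  intro j k c hk hc hkc _ hcert hmin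
  obtain ⟨k', hk'1, hk'j, hk', ψ, hψ, hne, hv⟩ := exists_endShape_of_minimal_certificate W 3 D.f hcert hmin
  obtain ⟨q, hq, hle⟩ := hEnd k' k c hk'1 (by omega) hc hkc ψ hψ hne hv
  have hle' : padicValRat 3 q ≤ ((s + j : ℕ) : ℤ) := by
    have : ((k' - 1 : ℕ) : ℤ) ≤ (j : ℤ) := by exact_mod_cast (show k' - 1 ≤ j by omega)
    push_cast at hle ⊢
    linarith
  exact kuriharaPartial_zero_le_natCast_of_padicValRat_le W 3 D.f (by norm_num) hirr D.isNewformOf h0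
    hper hq hle'


/-! ### Item level with the hypotheses demanded on the crux's own rows only (`t = 0` binder carried; append) -/

/-- **Crux `ShallowEqDeepAtTorsionFree` ⟸ crux `DeepUpperAtThree` + the threshold-free lane (C) on the
crux's OWN rows** (inline hypothesis `H`, with the `E(ℚ₃)[3] = 0` binder among its binders — so `H` is
asked only where 19077 is asked; at `t ≥ 1` the lane has threshold `2t + 1` and (C) is the cell memo's
OPEN Conjecture S, which this theorem does not assume). [cite: Kim2025RefinedTNC, Thm 1.1]
[cite: Kim2022StructureSelmer, §1.5.1 (PDF p. 7)] -/
theorem shallowEqDeepAtTorsionFree_of_deepUpperAtThree_of_certificateBoundTorsionFree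
    (hU : DeepUpperAtThree)
    (H : ∀ (W : WeierstrassCurve ℚ) [W.IsElliptic] [W.IsGloballyMinimal],
      (∀ n : ℕ, W.HasSurjectiveModNGaloisRep (3 ^ n : ℕ)) →
      Nat.card {Q : (W.baseChange ℚ_[3]).toAffine.Point // (3 : ℕ) • Q = 0} = 1 → Finite W.sha →
      ∀ {N : ℕ} [NeZero N] (f : CuspForm (Gamma0 N) 2), IsNewformOf W f →
      (∀ r : ℚ, ratPlusSymbol f r ≠ 0 → 0 ≤ padicValRat 3 (ratPlusSymbol f r)) →
      kuriharaVanishingOrder W 3 f = 0 →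
      ∀ j n : ℕ, IsCyclicKolyvaginLevel W 3 n → ¬ KuriharaDivisibleAt W 3 f n (j + 1) →
        kuriharaPartial W 3 f 0 ≤
          ((padicValNat 3 (Nat.card (AddCommGroup.primaryComponent W.sha 3)) + j : ℕ) : ℕ∞)) :
    ShallowEqDeepAtTorsionFree := by
  intro W _ _ htower ht0 hfin N _ f hf hint hord
  exact shallowEqDeep_conclusion_of_deepUpper_of_certificateBound W 3 f _
    (hU W htower hfin f hf hint hord) (H W htower ht0 hfin f hf hint hord)

/-- **Crux `ShallowEqDeepAtTorsionFree` ⟸ crux `DeepUpperAtThree` + the `K = 1` MINIMAL-certificate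
statement on the crux's OWN rows** (`t = 0` binder carried; kim3's hypothesis shape otherwise — at
`t = 0` the conclusion of n1011's END theorem, threshold `2t + 1 = 1`). The version without the
`t = 0` binder is `shallowEqDeepAtTorsionFree_of_deepUpperAtThree_of_minimalCertificateBound`.
[cite: Kim2025RefinedTNC, Thm 1.1] [cite: Kim2022StructureSelmer, Thm. 1.9 (6), Thm. 3.13] -/
theorem shallowEqDeepAtTorsionFree_of_deepUpperAtThree_of_minimalCertificateBoundTorsionFree
    (hU : DeepUpperAtThree)
    (H₀ : ∀ (W : WeierstrassCurve ℚ) [W.IsElliptic] [W.IsGloballyMinimal],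
      (∀ n : ℕ, W.HasSurjectiveModNGaloisRep (3 ^ n : ℕ)) →
      Nat.card {Q : (W.baseChange ℚ_[3]).toAffine.Point // (3 : ℕ) • Q = 0} = 1 → Finite W.sha →
      ∀ {N : ℕ} [NeZero N] (f : CuspForm (Gamma0 N) 2), IsNewformOf W f →
      (∀ r : ℚ, ratPlusSymbol f r ≠ 0 → 0 ≤ padicValRat 3 (ratPlusSymbol f r)) →
      kuriharaVanishingOrder W 3 f = 0 →
      ∀ j k c : ℕ, 1 + j ≤ k → IsCyclicKolyvaginLevel W 3 c →
        Kato.IsKolyvaginProduct W 3 k c → c ≠ 1 → ¬ KuriharaDivisibleAt W 3 f c (j + 1) →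
        (∀ d, d ∣ c → d ≠ 1 → d ≠ c → KuriharaDivisibleAt W 3 f d (j + 1)) →
          kuriharaPartial W 3 f 0 ≤
            ((padicValNat 3 (Nat.card (AddCommGroup.primaryComponent W.sha 3)) + j : ℕ) : ℕ∞)) :
    ShallowEqDeepAtTorsionFree := by
  intro W _ _ htower ht0 hfin N _ f hf hint hord
  exact shallowEqDeep_conclusion_of_deepUpper_of_minimalCertificateBound W 3 f _
    (hU W htower hfin f hf hint hord) (H₀ W htower ht0 hfin f hf hint hord)

end Summit.BirchSwinnertonDyer.BirchSwinnertonDyer.Theorems.KimAtThreeShallowEqDeepCertificateBound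

end
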